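/-
Copyright (c) 2026 the pub-hodgecm-mathlib formalisation cell (harness21).  Prover seat hodgecm-mathlib-K2E4-p01 (g2), Track B ∕ K2-LIT,
h413 = `stmt-HodgeConjecture-24833`; road «(B)∣split» (HC density at the centre of `GL₂ × GL₁`), FILE B2.  2026-09-03.
-/
import Summits.HodgeConjecture.HodgeConjecture.Theorems.K2E3GLTwoRamifiedShellStabilizers   -- ★ FILE B1 (this seat): shells = double cosets, weights `[A_0 : A_r] = q^r`
import Literature.NumberTheory.Automorphic.OrbitalIntegralDoubleCosetUnfolding            -- ★ Laumon unfolding `orbitalIntegral_quotientMeasure_eq_sum_of_isClosed`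
import Literature.NumberTheory.Automorphic.ReductiveGroupData                            -- ★ `glInt`, `isOpen_glInt`, `isCompact_glInt`
import Literature.MeasureTheory.Group.SubgroupRelIndexMeasure                            -- ★ `measure_subgroup_eq_relIndex_mul`
import Mathlib.NumberTheory.LocalField.Basic
import HarnessLib

/-!
# h413 ∕ Track B «K2-LIT» — HC density at the centre of `GL₂(F) × GL₁(F)`, FILE B2: the orbital integral at a deep ramified-torus class
# as a SHELL SUM `O_{(γ, a)}(ψ) = w₀ · Σ_r q^r ψ(r_r⁻¹ γ r_r, a)` (Labesse–Langlands 1979 §2; Laumon's unfolding)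

Cell `pub/hodgecm-mathlib`, crux H413 = `stmt-HodgeConjecture-24833` (supports-only); E3 socket (B) `sig_K2E3CentralTransferVanishing` at a split place via
K2E4-p02 (g0)'s interface (HC₁^P).  `P = GL₂(F) × GL₁(F)`, `K_P = GL₂(𝒪) × GL₁(𝒪)`, Eisenstein torus `T = C(γτ)` (`γτ = (0, v; 1, u)`, `|u| < 1`, `|v| = |ϖ|`),
`γ ∈ GL₂(F)` any element with `C(γ) = C(γτ)` (the deep elements `z(1 + ϖⁿτ)` of FILE A), `a ∈ GL₁(F)`, `Γ = (γ, a)`, `C = C_P(Γ) = T × GL₁(F)`,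
shell representatives `X_r = (r_r⁻¹, 1)`, `r_r = diag(1, ϖ^r)`.

FILE B1 (★ `K2E3GLTwoRamifiedShellStabilizers`) supplies the shell index on `P`, the constancy of values and stabilisers on double cosets and the weight
law `[A_0 : A_r] = q^r`; here `ρ(A_0) = q^r ρ(A_r)` (★ `measure_subgroup_eq_relIndex_mul`) is fed into Laumon's unfolding (★ `orbitalIntegral_quotientMeasure_eq_sum_of_isClosed`):
* §4 **THE SHELL SUM** `orbitalIntegral_eq_sum_range_shell`: for `ψ ∈ C_c(P)` invariant under `K_P`-conjugation and a closed class,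
  `O_Γ^{ν∕ρ}(ψ) = Σ_{r < R} (w₀ q^r) • ψ(X_r Γ X_r⁻¹)`, `w₀ = ν(K_P)∕ρ(A_0)`, for every `R` beyond the support (`exists_forall_le_apply_shellConj_eq_zero`).

HONEST LABEL: HC_CM is proved only modulo the 7 printed citations (2 remaining named inputs: hLiu418 = `stmt-HodgeConjecture-24832`,
h413 = `stmt-HodgeConjecture-24833`) until rung 0 closes; this file moves no counter.

## References
* [LabesseLanglands1979] J.-P. Labesse, R. P. Langlands, *L-indistinguishability for SL(2)*, Canad. J. Math. 31 (1979), §2 p. 8 (`T̃∖G̃∕K̃`, reps `diag(1, ϖ^m)`, `δ_m`).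
* [Laumon1995] G. Laumon, *Cohomology of Drinfeld Modular Varieties* I (1996), Lemma (5.3.2) p. 136.
* [Rogawski1990] J. D. Rogawski, *Automorphic Representations of Unitary Groups in Three Variables* (1990), §4.9 p. 54.
-/

set_option autoImplicit false
set_option linter.dupNamespace false

noncomputable section

open scoped ValuativeRel Matrix MatrixGroups ENNReal
open Matrix ValuativeRel MeasureTheory Measure Topology
open Literature.MeasureTheory.Group Literature.NumberTheory.Automorphic Literature.NumberTheory.Automorphic.HermitianLatticeTree
open Summit.HodgeConjecture.HodgeConjecture.Cruxes.H413.K2E3GLTwoRamifiedShellShift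
open Summit.HodgeConjecture.HodgeConjecture.Cruxes.H413.K2E3GLTwoRamifiedShellStabilizers

namespace Summit.HodgeConjecture.HodgeConjecture.Cruxes.H413.K2E3GLTwoRamifiedShellUnfolding

variable {F : Type*} [Field F] [ValuativeRel F]

/-! ## §4 THE SHELL SUM: the orbital integral at `(γ, a)` unfolded over `K_P \ P / C ≅ ℕ` -/

section ShellSum

variable [TopologicalSpace F] [IsNonarchimedeanLocalField F] {ϖ : F} (hϖ : IsUniformizingElement ϖ)
  [MeasurableSpace (GL (Fin 2) F × GL (Fin 1) F)] [BorelSpace (GL (Fin 2) F × GL (Fin 1) F)]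
  [T2Space (GL (Fin 2) F × GL (Fin 1) F)] [LocallyCompactSpace (GL (Fin 2) F × GL (Fin 1) F)]
  [SecondCountableTopology (GL (Fin 2) F × GL (Fin 1) F)]

omit [MeasurableSpace (GL (Fin 2) F × GL (Fin 1) F)] [BorelSpace (GL (Fin 2) F × GL (Fin 1) F)] [T2Space (GL (Fin 2) F × GL (Fin 1) F)]
  [LocallyCompactSpace (GL (Fin 2) F × GL (Fin 1) F)] [SecondCountableTopology (GL (Fin 2) F × GL (Fin 1) F)] in
/-- `K_P = GL₂(𝒪) × GL₁(𝒪)` is open (★ `isOpen_glInt`). [cite: PlatonovRapinchuk1994, §3.3] -/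
theorem isOpen_prodGlInt : IsOpen (((glInt 2 F).prod (glInt 1 F) : Subgroup (GL (Fin 2) F × GL (Fin 1) F)) : Set (GL (Fin 2) F × GL (Fin 1) F)) := by
  rw [Subgroup.coe_prod]
  exact (isOpen_glInt 2 F).prod (isOpen_glInt 1 F)

omit [MeasurableSpace (GL (Fin 2) F × GL (Fin 1) F)] [BorelSpace (GL (Fin 2) F × GL (Fin 1) F)] [T2Space (GL (Fin 2) F × GL (Fin 1) F)]
  [LocallyCompactSpace (GL (Fin 2) F × GL (Fin 1) F)] [SecondCountableTopology (GL (Fin 2) F × GL (Fin 1) F)] in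
/-- `K_P = GL₂(𝒪) × GL₁(𝒪)` is compact (★ `isCompact_glInt`). [cite: PlatonovRapinchuk1994, §3.3] -/
theorem isCompact_prodGlInt : IsCompact (((glInt 2 F).prod (glInt 1 F) : Subgroup (GL (Fin 2) F × GL (Fin 1) F)) : Set (GL (Fin 2) F × GL (Fin 1) F)) := by
  rw [Subgroup.coe_prod]
  exact (isCompact_glInt 2 F).prod (isCompact_glInt 1 F)

omit [MeasurableSpace (GL (Fin 2) F × GL (Fin 1) F)] [BorelSpace (GL (Fin 2) F × GL (Fin 1) F)] in
include hϖ in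
/-- **A SUPPORT BOUND IN SHELLS**: for `ψ` compactly supported and `K_P`-conjugation-invariant, at a closed class, the shell terms vanish beyond some `R`:
`∀ r ≥ R, ψ(X_r Γ X_r⁻¹) = 0` (★ `finite_setOf_conj_out_ne_zero_of_isClosed`: finitely many double cosets carry the support). [cite: Laumon1995, Lemma (5.3.2) p. 136] -/
theorem exists_forall_le_apply_shellConj_eq_zero {u v : F} (hu : u ∈ 𝒪[F]) (hv : v ∈ 𝒪[F])
    (hE : ∀ p q : F, valuation F (p ^ 2 + p * q * u - q ^ 2 * v) ≤ 1 → p ∈ 𝒪[F] ∧ q ∈ 𝒪[F])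
    {γτ γ : GL (Fin 2) F} (hγτ : (γτ : Matrix (Fin 2) (Fin 2) F) = !![0, v; 1, u])
    (hC : Subgroup.centralizer ({γ} : Set (GL (Fin 2) F)) = Subgroup.centralizer ({γτ} : Set (GL (Fin 2) F))) (a : GL (Fin 1) F)
    {rm : ℕ → GL (Fin 2) F} (hrm : ∀ m, (rm m : Matrix (Fin 2) (Fin 2) F) = Matrix.diagonal ![1, ϖ ^ m])
    (hO : IsClosed {g : GL (Fin 2) F × GL (Fin 1) F | ∃ y : GL (Fin 2) F × GL (Fin 1) F, y * (γ, a) * y⁻¹ = g})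
    {E : Type*} [TopologicalSpace E] [Zero E] {ψ : GL (Fin 2) F × GL (Fin 1) F → E} (hψs : HasCompactSupport ψ)
    (hψK : ∀ k ∈ (glInt 2 F).prod (glInt 1 F), ∀ y, ψ (k * y * k⁻¹) = ψ y) :
    ∃ R : ℕ, ∀ r, R ≤ r → ψ ((((rm r)⁻¹, 1) : GL (Fin 2) F × GL (Fin 1) F) * (γ, a) * (((rm r)⁻¹, 1) : GL (Fin 2) F × GL (Fin 1) F)⁻¹) = 0 := by
  classical
  have hfin := finite_setOf_conj_out_ne_zero_of_isClosed (γ, a) ((glInt 2 F).prod (glInt 1 F)) hO isOpen_prodGlInt hψs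
  obtain ⟨idx, hidx₁, hidx₂⟩ := exists_shellIndex_prod hϖ hu hv hE hγτ hC a rm hrm
  refine ⟨(hfin.toFinset.image fun q => idx q.out).sup id + 1, fun r hr => ?_⟩
  by_contra hne
  obtain ⟨h', k', hh', hk', hout⟩ := DoubleCoset.mk_out_eq_mul ((glInt 2 F).prod (glInt 1 F))
    (Subgroup.centralizer ({(γ, a)} : Set (GL (Fin 2) F × GL (Fin 1) F))) ((((rm r)⁻¹, 1) : GL (Fin 2) F × GL (Fin 1) F))
  set q := DoubleCoset.mk ((glInt 2 F).prod (glInt 1 F)) (Subgroup.centralizer ({(γ, a)} : Set (GL (Fin 2) F × GL (Fin 1) F)))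
    ((((rm r)⁻¹, 1) : GL (Fin 2) F × GL (Fin 1) F)) with hq
  have hval := apply_conj_eq_of_eq_mul (Γ := (γ, a)) rfl ψ hψK hh' hk' hout
  have hqmem : q ∈ hfin.toFinset := by
    rw [Set.Finite.mem_toFinset, Set.mem_setOf_eq, hval]; exact hne
  have hidxq : idx q.out = r := hidx₂ _ h' k' r hh' hk' hout
  have hle : r ≤ (hfin.toFinset.image fun q => idx q.out).sup id := by
    rw [← hidxq]
    exact Finset.le_sup (f := id) (Finset.mem_image_of_mem _ hqmem)
  omega

include hϖ in
/-- **THE SHELL SUM** (Labesse–Langlands' `∫_{T̃∖G̃} f(x̃⁻¹ t x̃) dx̃ = Σ_m C_m ∫ f(k⁻¹α_m⁻¹ t α_m k)`, `C_m ∝ q^m`, via Laumon's unfolding): for `ψ ∈ C_c(P)` invariant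
under `K_P`-conjugation, `Γ = (γ, a)` with `C(γ) = C(γτ)` (Eisenstein torus) and a closed class, `ρ` a Haar-type measure on `C = C_P(Γ)`, `ν` a Haar measure on `P`,
and any shell bound `R` of the support:
`O_Γ^{ν∕ρ}(ψ) = Σ_{r < R} (ν(K_P)∕ρ(A_0) · q^r) • ψ(X_r Γ X_r⁻¹)`, `X_r = (r_r⁻¹, 1)`, `A_0 = {c ∈ C | c ∈ K_P}`.
[cite: LabesseLanglands1979, §2 p. 8] [cite: Laumon1995, Lemma (5.3.2) p. 136] [cite: Rogawski1990, §4.9 p. 54] -/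
theorem orbitalIntegral_eq_sum_range_shell {u v : F} (hu : u ∈ 𝒪[F]) (hu1 : valuation F u < 1) (hv1 : valuation F v = valuation F ϖ)
    {γτ γ : GL (Fin 2) F} (hγτ : (γτ : Matrix (Fin 2) (Fin 2) F) = !![0, v; 1, u])
    (hC : Subgroup.centralizer ({γ} : Set (GL (Fin 2) F)) = Subgroup.centralizer ({γτ} : Set (GL (Fin 2) F))) (a : GL (Fin 1) F)
    {rm : ℕ → GL (Fin 2) F} (hrm : ∀ m, (rm m : Matrix (Fin 2) (Fin 2) F) = Matrix.diagonal ![1, ϖ ^ m])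
    (hO : IsClosed {g : GL (Fin 2) F × GL (Fin 1) F | ∃ y : GL (Fin 2) F × GL (Fin 1) F, y * (γ, a) * y⁻¹ = g})
    [∀ Γ : GL (Fin 2) F × GL (Fin 1) F, MeasurableSpace ((GL (Fin 2) F × GL (Fin 1) F) ⧸ Subgroup.centralizer ({Γ} : Set (GL (Fin 2) F × GL (Fin 1) F)))]
    [∀ Γ : GL (Fin 2) F × GL (Fin 1) F, BorelSpace ((GL (Fin 2) F × GL (Fin 1) F) ⧸ Subgroup.centralizer ({Γ} : Set (GL (Fin 2) F × GL (Fin 1) F)))]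
    {E : Type*} [NormedAddCommGroup E] [NormedSpace ℝ E] [CompleteSpace E] {ψ : GL (Fin 2) F × GL (Fin 1) F → E} (hψc : Continuous ψ)
    (hψs : HasCompactSupport ψ) (hψK : ∀ k ∈ (glInt 2 F).prod (glInt 1 F), ∀ y, ψ (k * y * k⁻¹) = ψ y)
    (ρ : Measure (Subgroup.centralizer ({(γ, a)} : Set (GL (Fin 2) F × GL (Fin 1) F)))) [ρ.IsMulLeftInvariant] [IsFiniteMeasureOnCompacts ρ]
    [ρ.IsOpenPosMeasure] [ρ.IsInvInvariant] [SFinite ρ]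
    (ν : Measure (GL (Fin 2) F × GL (Fin 1) F)) [ν.IsHaarMeasure] [ν.IsMulRightInvariant]
    {R : ℕ} (hR : ∀ r, R ≤ r → ψ ((((rm r)⁻¹, 1) : GL (Fin 2) F × GL (Fin 1) F) * (γ, a) * (((rm r)⁻¹, 1) : GL (Fin 2) F × GL (Fin 1) F)⁻¹) = 0) :
    orbitalIntegral (γ, a) ψ (quotientMeasure (Subgroup.centralizer ({(γ, a)} : Set (GL (Fin 2) F × GL (Fin 1) F))) ρ
        (isClosed_coe_centralizer_singleton (γ, a)) ν) =
      ∑ r ∈ Finset.range R,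
        ((ν ((glInt 2 F).prod (glInt 1 F)) / ρ (((glInt 2 F).prod (glInt 1 F)).comap ((MulAut.conj (1 : GL (Fin 2) F × GL (Fin 1) F)).toMonoidHom.comp
            (Subgroup.centralizer ({(γ, a)} : Set (GL (Fin 2) F × GL (Fin 1) F))).subtype))).toReal *
          (Nat.card (IsLocalRing.ResidueField 𝒪[F]) : ℝ) ^ r) •
        ψ ((((rm r)⁻¹, 1) : GL (Fin 2) F × GL (Fin 1) F) * (γ, a) * (((rm r)⁻¹, 1) : GL (Fin 2) F × GL (Fin 1) F)⁻¹) := by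
  classical
  have hv : v ∈ 𝒪[F] := by rw [Valuation.mem_integer_iff, hv1]; exact hϖ.valuation_le_one
  have hE := quadNormForm_integral_of_eisenstein hϖ hu hu1 hv1
  set KP := (glInt 2 F).prod (glInt 1 F) with hKPdef
  haveI hCl : IsClosed ((Subgroup.centralizer ({(γ, a)} : Set (GL (Fin 2) F × GL (Fin 1) F))) : Set (GL (Fin 2) F × GL (Fin 1) F)) := isClosed_coe_centralizer_singleton (γ, a)
  have hKo : IsOpen (KP : Set (GL (Fin 2) F × GL (Fin 1) F)) := isOpen_prodGlInt
  have hKc : IsCompact (KP : Set (GL (Fin 2) F × GL (Fin 1) F)) := isCompact_prodGlInt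
  have hcomm : ∀ x y : (Subgroup.centralizer ({(γ, a)} : Set (GL (Fin 2) F × GL (Fin 1) F))), x * y = y * x := centralizer_pair_mul_comm hγτ hC a
  -- the finitely many contributing double cosets
  have hfin := finite_setOf_conj_out_ne_zero_of_isClosed (γ, a) KP hO hKo hψs
  set s := hfin.toFinset with hsdef
  have hs : ∀ q, q ∉ s → ψ (q.out * (γ, a) * q.out⁻¹) = 0 := fun q hq => by
    by_contra h
    exact hq (hfin.mem_toFinset.2 h)
  rw [orbitalIntegral_quotientMeasure_eq_sum_of_isClosed (γ, a) KP ρ ν hO hKo hKc hψc hψs hψK s hs]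
  obtain ⟨idx, hidx₁, hidx₂⟩ := exists_shellIndex_prod hϖ hu hv hE hγτ hC a rm hrm
  -- the stabilisers, their masses and the weight law
  set X : ℕ → GL (Fin 2) F × GL (Fin 1) F := fun r => ((rm r)⁻¹, 1) with hX
  set A : (GL (Fin 2) F × GL (Fin 1) F) → Subgroup (Subgroup.centralizer ({(γ, a)} : Set (GL (Fin 2) F × GL (Fin 1) F))) := fun x => KP.comap ((MulAut.conj x).toMonoidHom.comp (Subgroup.centralizer ({(γ, a)} : Set (GL (Fin 2) F × GL (Fin 1) F))).subtype) with hA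
  have hAopen : ∀ x, IsOpen (A x : Set (Subgroup.centralizer ({(γ, a)} : Set (GL (Fin 2) F × GL (Fin 1) F)))) := fun x => by
    have : (A x : Set (Subgroup.centralizer ({(γ, a)} : Set (GL (Fin 2) F × GL (Fin 1) F)))) = (fun c : (Subgroup.centralizer ({(γ, a)} : Set (GL (Fin 2) F × GL (Fin 1) F))) => x * (c : GL (Fin 2) F × GL (Fin 1) F) * x⁻¹) ⁻¹' (KP : Set (GL (Fin 2) F × GL (Fin 1) F)) := by
      ext c; rw [SetLike.mem_coe, hA, mem_stab_iff]; rfl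
    rw [this]
    exact hKo.preimage ((continuous_const.mul continuous_subtype_val).mul continuous_const)
  have hA1 : (A 1 : Set (Subgroup.centralizer ({(γ, a)} : Set (GL (Fin 2) F × GL (Fin 1) F)))) = Subtype.val ⁻¹' (KP : Set (GL (Fin 2) F × GL (Fin 1) F)) := by
    ext c; rw [SetLike.mem_coe, hA, mem_stab_iff, one_mul, inv_one, mul_one]; rfl
  have hA1c : IsCompact (A 1 : Set (Subgroup.centralizer ({(γ, a)} : Set (GL (Fin 2) F × GL (Fin 1) F)))) := by
    rw [hA1]; exact hCl.isClosedEmbedding_subtypeVal.isCompact_preimage hKc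
  have hA1top : ρ (A 1 : Set (Subgroup.centralizer ({(γ, a)} : Set (GL (Fin 2) F × GL (Fin 1) F)))) ≠ ∞ := hA1c.measure_lt_top.ne
  have hw : ∀ r, A (X r) ≤ A 1 ∧ (A (X r)).relIndex (A 1) = Nat.card (IsLocalRing.ResidueField 𝒪[F]) ^ r := fun r =>
    stab_le_and_relIndex_eq hϖ hu hu1 hv1 hγτ hC a hrm r
  have hq0 : (Nat.card (IsLocalRing.ResidueField 𝒪[F]) : ℝ) ≠ 0 := by exact_mod_cast Nat.card_pos.ne'
  have hρeq : ∀ r, (ρ (A (X r) : Set (Subgroup.centralizer ({(γ, a)} : Set (GL (Fin 2) F × GL (Fin 1) F))))).toReal = (ρ (A 1 : Set (Subgroup.centralizer ({(γ, a)} : Set (GL (Fin 2) F × GL (Fin 1) F))))).toReal / (Nat.card (IsLocalRing.ResidueField 𝒪[F]) : ℝ) ^ r := fun r => by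
    obtain ⟨hle, hidxr⟩ := hw r
    have hne : (A (X r)).relIndex (A 1) ≠ 0 := by rw [hidxr]; exact pow_ne_zero _ Nat.card_pos.ne'
    have h := measure_subgroup_eq_relIndex_mul ρ hle (hAopen 1).measurableSet (hAopen (X r)).measurableSet hne
    rw [hidxr] at h
    have h' := congrArg ENNReal.toReal h
    rw [ENNReal.toReal_mul, ENNReal.toReal_natCast, Nat.cast_pow] at h'
    rw [h', eq_div_iff (pow_ne_zero _ hq0)]
    ring
  have hApos : ∀ x, (ρ (A x : Set (Subgroup.centralizer ({(γ, a)} : Set (GL (Fin 2) F × GL (Fin 1) F))))).toReal ≠ 0 := fun x => by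
    rw [ENNReal.toReal_ne_zero]
    refine ⟨((hAopen x).measure_pos ρ ⟨1, Subgroup.one_mem _⟩).ne', ?_⟩
    obtain ⟨k, hk, c, hc, hxe⟩ := hidx₁ x
    have hle : A x ≤ A 1 := (stab_eq_of_eq_mul hcomm hk hc hxe).trans_le (hw _).1
    exact (lt_of_le_of_lt (measure_mono (SetLike.coe_subset_coe.mpr hle)) hA1c.measure_lt_top).ne
  -- each summand depends on `q` only through the shell `idx q.out`
  set f : ℕ → E := fun r => ((ν KP / ρ (A 1 : Set (Subgroup.centralizer ({(γ, a)} : Set (GL (Fin 2) F × GL (Fin 1) F))))).toReal * (Nat.card (IsLocalRing.ResidueField 𝒪[F]) : ℝ) ^ r) • ψ (X r * (γ, a) * (X r)⁻¹) with hf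
  have hterm : ∀ q : DoubleCoset.Quotient (KP : Set (GL (Fin 2) F × GL (Fin 1) F)) ((Subgroup.centralizer ({(γ, a)} : Set (GL (Fin 2) F × GL (Fin 1) F))) : Set (GL (Fin 2) F × GL (Fin 1) F)),
      (ν KP / ρ {c : (Subgroup.centralizer ({(γ, a)} : Set (GL (Fin 2) F × GL (Fin 1) F))) | (q.out : GL (Fin 2) F × GL (Fin 1) F) * (c : GL (Fin 2) F × GL (Fin 1) F) * q.out⁻¹ ∈ KP}).toReal •
        ψ (q.out * (γ, a) * q.out⁻¹) = f (idx q.out) := by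
    intro q
    obtain ⟨k, hk, c, hc, hq⟩ := hidx₁ q.out
    have hAq : A q.out = A (X (idx q.out)) := stab_eq_of_eq_mul hcomm hk hc hq
    have hval : ψ (q.out * (γ, a) * q.out⁻¹) = ψ (X (idx q.out) * (γ, a) * (X (idx q.out))⁻¹) :=
      apply_conj_eq_of_eq_mul (Γ := (γ, a)) rfl ψ hψK hk hc hq
    have hset : {c : (Subgroup.centralizer ({(γ, a)} : Set (GL (Fin 2) F × GL (Fin 1) F))) |
        (q.out : GL (Fin 2) F × GL (Fin 1) F) * (c : GL (Fin 2) F × GL (Fin 1) F) * q.out⁻¹ ∈ KP} =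
        (A (X (idx q.out)) : Set (Subgroup.centralizer ({(γ, a)} : Set (GL (Fin 2) F × GL (Fin 1) F)))) := by
      rw [setOf_conj_mem_eq_coe_stab]
      exact congrArg SetLike.coe hAq
    rw [hval, hset, hf]
    simp only
    congr 1
    rw [ENNReal.toReal_div, ENNReal.toReal_div, hρeq, div_div_eq_mul_div]
    ring
  rw [Finset.sum_congr rfl fun q _ => hterm q]
  -- `q ↦ idx q.out` is injective
  have hinj : ∀ q₁ ∈ s, ∀ q₂ ∈ s, idx q₁.out = idx q₂.out → q₁ = q₂ := by
    intro q₁ _ q₂ _ h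
    obtain ⟨k₁, hk₁, c₁, hc₁, h₁⟩ := hidx₁ q₁.out
    obtain ⟨k₂, hk₂, c₂, hc₂, h₂⟩ := hidx₁ q₂.out
    rw [← DoubleCoset.out_eq' _ _ q₁, ← DoubleCoset.out_eq' _ _ q₂, DoubleCoset.eq]
    refine ⟨k₂ * k₁⁻¹, KP.mul_mem hk₂ (KP.inv_mem hk₁), c₁⁻¹ * c₂, Subgroup.mul_mem _ (Subgroup.inv_mem _ hc₁) hc₂, ?_⟩
    rw [h₂, ← h]
    conv_rhs => rw [h₁]
    group
  rw [← Finset.sum_image hinj]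
  -- the image of `s` lies in `range R`, and the missing shells contribute `0`
  refine Finset.sum_subset ?_ ?_
  · intro r hr
    obtain ⟨q, hq, rfl⟩ := Finset.mem_image.1 hr
    rw [Finset.mem_range]
    by_contra hlt
    have h0 := hR _ (not_lt.1 hlt)
    obtain ⟨k, hk, c, hc, hqe⟩ := hidx₁ q.out
    have := (hfin.mem_toFinset.1 hq)
    rw [Set.mem_setOf_eq, apply_conj_eq_of_eq_mul (Γ := (γ, a)) rfl ψ hψK hk hc hqe] at this
    exact this h0
  · intro r _ hr
    rw [hf]
    simp only
    suffices h0 : ψ (X r * (γ, a) * (X r)⁻¹) = 0 by rw [h0, smul_zero]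
    by_contra hne
    apply hr
    obtain ⟨h', k', hh', hk', hout⟩ := DoubleCoset.mk_out_eq_mul KP (Subgroup.centralizer ({(γ, a)} : Set (GL (Fin 2) F × GL (Fin 1) F))) (X r)
    have hval := apply_conj_eq_of_eq_mul (Γ := (γ, a)) rfl ψ hψK hh' hk' hout
    refine Finset.mem_image.2 ⟨DoubleCoset.mk KP (Subgroup.centralizer ({(γ, a)} : Set (GL (Fin 2) F × GL (Fin 1) F))) (X r), ?_, hidx₂ _ h' k' r hh' hk' hout⟩
    rw [hsdef, Set.Finite.mem_toFinset, Set.mem_setOf_eq, hval]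
    exact hne

end ShellSum

end Summit.HodgeConjecture.HodgeConjecture.Cruxes.H413.K2E3GLTwoRamifiedShellUnfolding

end
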